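import Literature.Geometry.Kaehler.ComplexTorusMaximalCMSubfieldCenter
import Literature.Geometry.Kaehler.ComplexTorusRosatiAlbert
import Literature.RingTheory.CentralSimple.PositiveInvolutionSubfield
import HarnessLib

/-!
# The centre of `End⁰(X)` for a maximal commutative CM subfield is a CM field
# (Zarhin, Crelle 544 (2002), Theorem 3.8 (i), literal form "`𝒞` is a CM-subfield of `ℚ(δ_p)`")

Layer `Literature/Geometry/Kaehler`, namespace `Literature.Geometry.Kaehler.ComplexTorus`; lane
`lit-hodgefound` (Track 2 foundations library), seat p11, generation 16, row g16-#4. Sequel, BY NAME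
(nothing restated), of

* this seat's `ComplexTorusMaximalCMSubfieldCenter.lean` (g16-#2): Theorem 3.8 (i) in the form "the centre
  is NOT totally real" — `exists_center_not_mem_maximalRealSubfield` (a central `f(k)` with `k ∉ K⁺`);
* `Literature/RingTheory/CentralSimple/PositiveInvolutionSubfield.lean` (p22 g3): a `′`-stable number
  field inside a positive pair `(D, ′)` is totally real or CM —
  `IsPositiveAntiInvolution.isTotallyReal_or_isCMField_of_algHom`, `exists_linearMap_of_forall_apply_mem_range`,
  `IsAntiInvolution.apply_mem_center` (Lange Lemma 2.6.4 / 2.6.6, Shimura §5.1 Lemma 2, Mumford §21);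
* `ComplexTorusRosatiAlbert.lean`: the Rosati involution of a polarisation is a positive anti-involution of
  `End_ℚ(X) = endAlgRat Φ` (`IsRiemannForm.isPositiveAntiInvolution_rosati`, `rosatiEnd`).

THEOREMS ONLY (no definition, no named fact; net debt 0).

## Source, verbatim

Yu. G. Zarhin, *Cyclic covers of the projective line, their jacobians and endomorphisms*, J. reine angew.
Math. 544 (2002) (bib `Zarhin2002CyclicCovers`; held text `paper:arxiv-math_0008134`), §3, p0008:
"**Theorem 3.8.** Suppose `n ≥ 4` and `p > 2`. Assume that `ℚ(δ_p)` is a maximal commutative subalgebra in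
`End⁰(J^{(f,p)})`. Then: (i) The center `𝒞` of `End⁰(J^{(f,p)})` is a CM-subfield of `ℚ(δ_p)`; […]
*Proof.* Clearly, `𝒞 ⊂ ℚ(δ_p)`. Since `ℚ(δ_p)` is a CM-field, `𝒞` is either a totally real field or a
CM-field. […] In order to prove (i), let us assume that `𝒞` is totally real. We are going to arrive to a
contradiction which proves (i)."

## Statement formalised (torus level)

For a polarised complex torus `(X = E/Φ(ℤ^ι), η)` of positive dimension and a CM field `K` (Mathlib
`IsCMField`) embedded `f : K ↪ End⁰(X)` as a maximal commutative (self-centralising) subalgebra, with one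
pair of tangent multiplicities `n_σ ≠ n_σ̄` (the curve-side [Koo] input of the printed proof, as in g16-#2):
**`exists_subfield_center_isCMField`** — the pull-back `C = f⁻¹𝒞 ⊆ K` of the centre `𝒞 = Z(End⁰(X))`
(`𝒞 ⊆ f(K)`, so `C ≅ 𝒞`) is a subfield of `K` which IS A CM FIELD, `IsCMField ↥C`.

PROOF, following the printed dichotomy: "`𝒞` is either a totally real field or a CM-field" — in the print
because `𝒞 ⊂ ℚ(δ_p)` with `ℚ(δ_p)` CM; here (for an arbitrary CM field `K`, whose subfields need not be
conjugation-stable) from the ROSATI involution `′` of the polarisation: `′` is a positive anti-involution of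
`End⁰(X)` (Lange Thm. 2.4.9 / `isPositiveAntiInvolution_rosati`) mapping the centre to itself, so the
number field `C ≅ 𝒞` is `′`-stably embedded in the positive pair `(End⁰(X), ′)` and is therefore totally
real or CM (Lange Lemma 2.6.4 + 2.6.6 = the tree's `isTotallyReal_or_isCMField_of_algHom`); and "`𝒞`
totally real" is excluded by g16-#2's Theorem 3.8 (i) (`exists_center_not_mem_maximalRealSubfield`: some
`k ∈ C` lies outside `K⁺`, whereas a totally real subfield lies in `K⁺`, Mathlib
`isTotallyReal_iff_le_maximalRealSubfield`). Also recorded: `exists_subfield_center` (the centre pulls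
back to a subfield `C` of `K`, for any number field `K` maximal commutative in `End⁰(X)`) and
`subfield_center_isTotallyReal_or_isCMField` (the dichotomy itself at torus level, no CM / multiplicity
hypothesis).

## References

* [Zarhin2002CyclicCovers] Yu. G. Zarhin, J. reine angew. Math. 544 (2002), §3 Thm. 3.8 (i) and proof (p0008).
* [Lange2023AbelianVarietiesComplex] H. Lange, Abelian Varieties over the Complex Numbers (2023), §2.4.2
  Thm. 2.4.9 (Rosati positive), §2.6.2 Lemma 2.6.4, Lemma 2.6.6.
* [Shimura1998] G. Shimura, Abelian Varieties with Complex Multiplication and Modular Functions (1998),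
  §5.1 Lemma 2 and Prop. 4.
-/

noncomputable section

open Module NumberField
open scoped ComplexConjugate

namespace Literature.Geometry.Kaehler

namespace ComplexTorus

open Literature.RingTheory.CentralSimple

variable {ι : Type*} [Fintype ι] [DecidableEq ι] {E : Type*} [NormedAddCommGroup E] [NormedSpace ℂ E]
  [FiniteDimensional ℂ E] (Φ : (ι → ℝ) ≃L[ℝ] E) {η : E [⋀^Fin 2]→L[ℝ] ℝ}
  {K : Type*} [Field K] [NumberField K] (f : K →ₐ[ℚ] Matrix ι ι ℚ) (hf : ∀ x, f x ∈ endAlgRat Φ)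

include hf in
omit [FiniteDimensional ℂ E] in
/-- **The centre pulls back to a subfield of `K`.** For a number field `f : K ↪ End⁰(X)` the elements
`k ∈ K` with `f(k)` central in `End⁰(X)` form a subfield `C` of `K` ("Clearly, `𝒞 ⊂ ℚ(δ_p)`"; `C ≅ 𝒞` when
`f(K)` is maximal commutative). [cite: Zarhin2002CyclicCovers, §3 proof of Thm 3.8 ("Clearly, `𝒞 ⊂ ℚ(δ_p)`", p0008)] -/
theorem exists_subfield_center :
    ∃ C : Subfield K, ∀ k : K, k ∈ C ↔ ∀ B ∈ endAlgRat Φ, B * f k = f k * B := by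
  classical
  let f' : K →ₐ[ℚ] endAlgRat Φ := f.codRestrict (endAlgRat Φ) hf
  let C₀ : Subalgebra ℚ K := (Subalgebra.center ℚ (endAlgRat Φ)).comap f'
  have hC₀ : ∀ k : K, k ∈ C₀ ↔ ∀ B ∈ endAlgRat Φ, B * f k = f k * B := fun k ↦ by
    change f' k ∈ Subalgebra.center ℚ (endAlgRat Φ) ↔ _
    rw [Subalgebra.mem_center_iff]
    exact ⟨fun h B hB ↦ congrArg Subtype.val (h ⟨B, hB⟩), fun h a ↦ Subtype.ext (h a.1 a.2)⟩
  let C₁ : IntermediateField ℚ K := C₀.toIntermediateField' (Subalgebra.isField_of_algebraic C₀)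
  refine ⟨C₁.toSubfield, fun k ↦ ?_⟩
  rw [← hC₀]
  exact Iff.rfl

omit [FiniteDimensional ℂ E] in
/-- **"`𝒞` is either a totally real field or a CM-field"** — at torus level, for ANY number field `K`
embedded as a maximal commutative subalgebra of `End⁰(X)`, `(X, η)` polarised of positive dimension: the
subfield `C = f⁻¹𝒞` of `K` is totally real or CM. (In the print from `𝒞 ⊂ ℚ(δ_p)`; here from the Rosati
involution of `η`, a positive anti-involution of `End⁰(X)` preserving the centre, and Lange's Lemma
2.6.4 / 2.6.6 for the `′`-stable number field `C ≅ 𝒞` — the tree's `isTotallyReal_or_isCMField_of_algHom`.)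
[cite: Zarhin2002CyclicCovers, §3 proof of Thm 3.8 (p0008)] [cite: Lange2023AbelianVarietiesComplex, §2.6.2 Lemma 2.6.4 and Lemma 2.6.6] -/
theorem subfield_center_isTotallyReal_or_isCMField (hf : ∀ x, f x ∈ endAlgRat Φ) [Nonempty ι] (hη : IsRiemannForm Φ η)
    (hmax : ∀ B ∈ endAlgRat Φ, (∀ k, B * f k = f k * B) → B ∈ Set.range f)
    {C : Subfield K} (hC : ∀ k : K, k ∈ C ↔ ∀ B ∈ endAlgRat Φ, B * f k = f k * B) :
    IsTotallyReal C ∨ IsCMField C := by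
  classical
  let f' : K →ₐ[ℚ] endAlgRat Φ := f.codRestrict (endAlgRat Φ) hf
  -- `C` is a number field, embedded in `End⁰(X)` by `g = f|_C`
  haveI : CharZero C := inferInstance
  haveI : FiniteDimensional ℚ C :=
    Module.Finite.of_injective (C.subtype.toRatAlgHom.toLinearMap) Subtype.val_injective
  haveI : NumberField C := NumberField.mk
  let g : C →ₐ[ℚ] endAlgRat Φ := f'.comp C.subtype.toRatAlgHom
  have hg : ∀ x : C, g x = f' (x : K) := fun x ↦ rfl
  -- the Rosati involution: a positive anti-involution of `End⁰(X)` preserving the centre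
  obtain ⟨G, hG⟩ := hη.exists_ratMatrix_latticeGram
  have hpos := hη.isPositiveAntiInvolution_rosati hG
  have hcen : ∀ x : C, f' (x : K) ∈ Subring.center (endAlgRat Φ) := fun x ↦ by
    rw [Subring.mem_center_iff]
    intro b
    exact Subtype.ext ((hC (x : K)).1 x.2 b.1 b.2)
  have hst : ∀ x : C, rosatiEnd Φ hη.1 hη.2.2 hG (g x) ∈ g.range := by
    intro x
    have hz := hpos.toIsAntiInvolution.apply_mem_center (hcen x)
    rw [Subring.mem_center_iff] at hz
    obtain ⟨k, hk⟩ := hmax _ (rosatiEnd Φ hη.1 hη.2.2 hG (g x)).2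
      fun k ↦ congrArg Subtype.val (hz (f' k)).symm
    have hkC : k ∈ C := (hC k).2 fun B hB ↦ by
      have h := congrArg Subtype.val (hz ⟨B, hB⟩)
      change B * _ = _ * B at h
      rw [hk]
      exact h
    exact (AlgHom.mem_range g).2 ⟨⟨k, hkC⟩, Subtype.ext hk⟩
  obtain ⟨τ, hτ⟩ := exists_linearMap_of_forall_apply_mem_range g hst
  exact hpos.isTotallyReal_or_isCMField_of_algHom g hτ

/-- **Theorem 3.8 (i), literal form: "The center `𝒞` of `End⁰` is a CM-subfield of `ℚ(δ_p)`."** For a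
polarised complex torus `(X, η)` of positive dimension and a CM field `K` embedded `f : K ↪ End⁰(X)` as a
maximal commutative subalgebra, with one pair of tangent multiplicities `n_σ ≠ n_σ̄` (the [Koo] input of
the printed proof, as hypothesis), the pull-back `C = f⁻¹𝒞` of the centre `𝒞 = Z(End⁰(X)) ⊆ f(K)` is a
subfield of `K` and a CM FIELD (`IsCMField ↥C`): it is totally real or CM by the Rosati dichotomy, and not
totally real by g16-#2's `exists_center_not_mem_maximalRealSubfield`.
[cite: Zarhin2002CyclicCovers, §3 Thm 3.8 (i) and its proof (p0008)] -/
theorem exists_subfield_center_isCMField [Nonempty ι] [IsCMField K] (hη : IsRiemannForm Φ η)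
    (hmax : ∀ B ∈ endAlgRat Φ, (∀ k, B * f k = f k * B) → B ∈ Set.range f)
    (hne : ∃ σ : K →+* ℂ,
      finrank ℂ ↥(⨅ y : K, Module.End.eigenspace
          ((analyticRepHom Φ ⟨f y, hf y⟩ : E →L[ℂ] E) : E →ₗ[ℂ] E) (σ y)) ≠
        finrank ℂ ↥(⨅ y : K, Module.End.eigenspace
          ((analyticRepHom Φ ⟨f y, hf y⟩ : E →L[ℂ] E) : E →ₗ[ℂ] E)
            (NumberField.ComplexEmbedding.conjugate σ y))) :
    ∃ C : Subfield K, (∀ k : K, k ∈ C ↔ ∀ B ∈ endAlgRat Φ, B * f k = f k * B) ∧ IsCMField C := by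
  obtain ⟨C, hC⟩ := exists_subfield_center Φ f hf
  refine ⟨C, hC, ?_⟩
  rcases subfield_center_isTotallyReal_or_isCMField Φ f hf hη hmax hC with hreal | hcm
  · exfalso
    obtain ⟨k, hk, hk'⟩ := exists_center_not_mem_maximalRealSubfield Φ f hf hη hmax hne
    exact hk' ((isTotallyReal_iff_le_maximalRealSubfield (E := C)).1 hreal ((hC k).2 hk))
  · exact hcm

end ComplexTorus

end Literature.Geometry.Kaehler
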